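import Literature.NumberTheory.EllipticCurves.HalfIntegralWeightForms
import Literature.NumberTheory.EllipticCurves.PAdicLFunctionMinus
import Literature.NumberTheory.EllipticCurves.Newforms
import HarnessLib

/-!
# The Chebotarev structure of the `2`-adic equality doors (p2 GEN 44, the Waldspurger face)

B1 honesty: this file proves NO number theory. It isolates, as two NAMED PRINT FACTS and one
pure-logic kernel, the exact extra input that turns the Kato inequality `corank ≤ ord_T L₂` into
EQUALITY ON AN INFINITE CLASS of twists: for a base newform `f₀` (odd squarefree level `N₀`) and a
"face" `q ↦ D(q) = -n₀ q` of fundamental discriminants in Kohnen's packet,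

* `KohnenSquareLaw` — Kohnen 1985 / Kohnen–Zagier / Baruch–Mao 2007 Thm 10.1 (`S = ∅`): the exact
  twisted minus-symbol sums `S(D) = ∑_{a mod |D|} χ_D(a) [a/|D|]⁻_{f₀}` are `κ · 2^{t(D)} · c(|D|)²`
  for the integer Fourier coefficients `c` of ONE cusp form `g` of weight `3/2` and level `4N₀`
  corresponding to `f₀` under Shimura's map, and `c(|D|) = 0` off the packet; hence the door's
  analytic binder (`v₂` of an `L`-value minimal) is the `2`-adic order of a coefficient `c(n₀ q)`;
* `HeckeCongruencePrimesInfinite` — Deligne–Serre + Chebotarev in the form of Ono, Crelle 533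
  (2001), Thm 2.2 (and its proof): for integral weight-`2` cusp forms `G_i` on `Γ₀(M)` and a prime
  `p₀`, infinitely many primes `p ≡ p₀ (mod m)` satisfy `G_i | T_p ≡ G_i | T_{p₀} (mod 2^j)`, in
  particular `a_i(n p) ≡ a_i(n p₀) (mod 2^j)` for `n` prime to `p p₀` (apply to `G = g θ ≡ g`);
* the kernel `door_branch_infinite` / `door_branch_empty_or_infinite`: if the door law of a prime
  is decided by that congruence data, ONE instance `p₀` makes the branch infinite, and each branch
  (`corank = ord_T = 3` versus `ord_T ≥ 5`, via the cell's door kernels) is empty or infinite.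

`ord_T L₂` is the `2`-adic order, never `r_an`; no S0 motion; Ш finiteness and BSD not claimed.
Memo: `pub/bsd-rank2/p2/g44/WALDSPURGER-FACE.md` (data: kit j329152, j329245, j329246).
-/

noncomputable section

open scoped MatrixGroups ModularForm

open CongruenceSubgroup NumberField
open Literature.NumberTheory.EllipticCurves Literature.NumberTheory.EllipticCurves.ModularForms

namespace Summit.BirchSwinnertonDyer.Rank2.ChebotarevDoorAtTwo

/-! ### §1 Objects: Kronecker symbol of a fundamental discriminant, Kohnen packet, the sums `S(D)` -/

/-- `D` is a fundamental discriminant: `D ≡ 1 (mod 4)` squarefree, or `D = 4m` with `m ≡ 2, 3 (mod 4)`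
squarefree. [folklore] -/
def IsFundDiscr (D : ℤ) : Prop :=
  (D % 4 = 1 ∧ Squarefree D) ∨ (∃ m : ℤ, D = 4 * m ∧ (m % 4 = 2 ∨ m % 4 = 3) ∧ Squarefree m)

/-- The Kronecker symbol `χ_D(a) = (D/a)` of a fundamental discriminant `D` at `a ≥ 1`, via Jacobi
symbols: for `D ≡ 1 (mod 4)` it is `(a/|D|)` (reciprocity), for `4 ∣ D` it is `(D/a)` at odd `a` and
`0` at even `a`. [folklore] -/
def kroneckerχ (D : ℤ) (a : ℕ) : ℤ :=
  if D % 4 = 1 then jacobiSym a D.natAbs else if a % 2 = 1 then jacobiSym D a else 0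

/-- The number `t(D)` of primes `ℓ ∣ N₀` dividing `D` (Baruch–Mao 2007, Thm 10.1: the factor
`2^{ν(N) - t}`). [cite: BaruchMao2007KohnenZagier, Thm 10.1] -/
def tCount (N₀ : ℕ) (D : ℤ) : ℕ :=
  (N₀.primeFactors.filter fun ℓ : ℕ => ((ℓ : ℕ) : ℤ) ∣ D).card

/-- Kohnen's packet (`S = ∅` in Baruch–Mao): `(D/ℓ) ≠ -w_ℓ = a_ℓ(f₀)` for every prime `ℓ ∣ N₀`
(for `ℓ ∣ D` the symbol is `0` and the condition holds). [cite: BaruchMao2007KohnenZagier, §10.1] -/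
def InKohnenPacket (N₀ : ℕ) [NeZero N₀] (f : CuspForm (Gamma0 N₀) 2) (D : ℤ) : Prop :=
  ∀ ℓ : ℕ, ℓ.Prime → ℓ ∣ N₀ → (kroneckerχ D ℓ : ℂ) ≠ heckeEigenvalue f ℓ

/-- The exact twisted minus-symbol sum `S(D) = ∑_{a mod |D|} χ_D(a) [a/|D|]⁻_{f₀} ∈ ℚ` of a rational
newform at a negative fundamental discriminant `D` (`= √|D| · L(f₀ ⊗ χ_D, 1)/Ω⁻` up to one fixed
rational, Birch / Mazur–Tate–Teitelbaum §I.8). [cite: MazurTateTeitelbaum1986Invent, §I.8 (8.6)] -/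
def kohnenSum {N₀ : ℕ} (f : CuspForm (Gamma0 N₀) 2) (D : ℤ) : ℚ :=
  ∑ a ∈ Finset.range D.natAbs, (kroneckerχ D a : ℚ) * ratMinusSymbol f ((a : ℚ) / D.natAbs)

/-- `x` has exact `2`-adic order `v`. [folklore] -/
def ExactTwoPow (v : ℕ) (x : ℤ) : Prop :=
  (2 : ℤ) ^ v ∣ x ∧ ¬ (2 : ℤ) ^ (v + 1) ∣ x

/-! ### §2 The two print facts -/

/-- **Kohnen–Zagier–Kohnen / Baruch–Mao square law, minus sign, packet `S = ∅`.** For a rational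
newform `f₀` of odd squarefree level `N₀` there are a cusp form `g` of weight `3/2`, level `4N₀`,
trivial character, in Waldspurger's space of `f₀` (a `T(p²)`-eigenform with the eigenvalues
`a_p(f₀)`), with INTEGER, primitive Fourier coefficients `c` supported on Kohnen's plus space, and a
rational `κ ≠ 0` such that for every negative fundamental discriminant `D`: in the packet
`S(D) = κ · 2^{t(D)} · c(|D|)²`, and off the packet `c(|D|) = 0`. (Baruch–Mao Thm 10.1 with `k = 1`,
`S = ∅`, `sgn D = (-1)^{s+k} = -1`, read through Birch's formula for `S(D)`; Kohnen 1985 for the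
rational normalisation.) [cite: BaruchMao2007KohnenZagier, Thm 10.1] [cite: Kohnen1985FourierCoefficients, Thm 1, Cor 1] -/
def KohnenSquareLaw (N₀ : ℕ) [NeZero N₀] : Prop :=
  ∀ (f : CuspForm (Gamma0 N₀) 2), IsNewform0 f → coeffField f = ⊥ → Odd N₀ → Squarefree N₀ →
    ∃ (c : ℕ → ℤ) (κ : ℚ), κ ≠ 0 ∧
      (∃ g ∈ shimuraSubspace 3 (4 * N₀) 1 (heckeEigenvalue f), ∀ n, qCoeffs g n = (c n : ℂ)) ∧
      (∃ n, Odd (c n)) ∧ (∀ n, n % 4 = 1 ∨ n % 4 = 2 → c n = 0) ∧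
      ∀ D : ℤ, D < 0 → IsFundDiscr D →
        (InKohnenPacket N₀ f D → kohnenSum f D = κ * 2 ^ tCount N₀ D * (c D.natAbs : ℚ) ^ 2) ∧
        (¬ InKohnenPacket N₀ f D → c D.natAbs = 0)

/-- **Hecke congruence primes are infinite (Deligne–Serre + Chebotarev; Ono 2001, Thm 2.2 and its
proof).** For finitely many cusp forms `G_i` of integral weight `k ≥ 1` on `Γ₀(M)` with integer
`q`-expansions `a_i`, every modulus `m ≥ 1`, every `j` and every prime `p₀ ∤ 2Mm`, there are
infinitely many primes `p ∤ 2Mm` with `p ≡ p₀ (mod m)` and `a_i(np) ≡ a_i(np₀) (mod 2^j)` for all `i`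
and all `n` prime to `p p₀` (the `n`-th coefficients of `G_i | T_p ≡ G_i | T_{p₀} (mod 2^j)`): the
primes whose Frobenius in the (finite) image of `⊕_h ρ_{h,λ} mod λ^{E+je+1}` (over the newforms `h`
occurring in the `G_i`) times `Gal(ℚ(ζ_m)/ℚ)` is conjugate to that of `p₀`; Chebotarev makes that
set infinite (indeed of positive density). Ono states it for one level and real Nebentypus; trivial
character and a common level suffice here. [cite: Ono2001Crelle, Thm 2.2 (p. 6) and proof] [cite: DeligneSerre1974, Thm 6.7] -/
def HeckeCongruencePrimesInfinite : Prop :=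
  ∀ (M : ℕ) [NeZero M] (k : ℤ) (r : ℕ) (G : Fin r → CuspForm (Gamma0 M) k) (a : Fin r → ℕ → ℤ),
    1 ≤ k → (∀ i n, qCoeffs (G i) n = (a i n : ℂ)) →
    ∀ (m j p₀ : ℕ), 0 < m → p₀.Prime → ¬ p₀ ∣ 2 * M * m →
      Set.Infinite {p : ℕ | p.Prime ∧ ¬ p ∣ 2 * M * m ∧ p ≡ p₀ [MOD m] ∧
        ∀ i n, Nat.Coprime n (p * p₀) → (2 : ℤ) ^ j ∣ a i (n * p) - a i (n * p₀)}

/-! ### §3 The pure-logic kernel -/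

/-- Congruence data of a prime relative to `p₀`: same class mod `m` and `a_i(np) ≡ a_i(np₀) (mod 2^j)`
for `n` prime to `p p₀`. [this file] -/
def CongData (M m j : ℕ) {r : ℕ} (a : Fin r → ℕ → ℤ) (p₀ p : ℕ) : Prop :=
  p.Prime ∧ ¬ p ∣ 2 * M * m ∧ p ≡ p₀ [MOD m] ∧
    ∀ i n, Nat.Coprime n (p * p₀) → (2 : ℤ) ^ j ∣ a i (n * p) - a i (n * p₀)

/-- A law on primes is **decided by the congruence data** `(m, j, a)` if primes with the same data
have the same law. [this file] -/
def DecidedBy (M m j : ℕ) {r : ℕ} (a : Fin r → ℕ → ℤ) (law : ℕ → Prop) : Prop :=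
  ∀ p₀ p : ℕ, p₀.Prime → ¬ p₀ ∣ 2 * M * m → CongData M m j a p₀ p → (law p ↔ law p₀)

/-- **Kernel: one instance ⇒ an infinite branch.** If the law is decided by the congruence data and
holds at one prime `p₀ ∤ 2Mm`, it holds at infinitely many primes `p ≡ p₀ (mod m)`, `p ∤ 2Mm`.
[this file] -/
theorem door_branch_infinite (hF : HeckeCongruencePrimesInfinite) {M : ℕ} [NeZero M] {k : ℤ}
    (hk : 1 ≤ k) {r : ℕ} (G : Fin r → CuspForm (Gamma0 M) k) (a : Fin r → ℕ → ℤ)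
    (ha : ∀ i n, qCoeffs (G i) n = (a i n : ℂ)) {m j : ℕ} (hm : 0 < m) {law : ℕ → Prop} (hlaw : DecidedBy M m j a law)
    {p₀ : ℕ} (hp₀ : p₀.Prime) (hp₀' : ¬ p₀ ∣ 2 * M * m) (h₀ : law p₀) :
    Set.Infinite {p : ℕ | p.Prime ∧ ¬ p ∣ 2 * M * m ∧ p ≡ p₀ [MOD m] ∧ law p} := by
  refine (hF M k r G a hk ha m j p₀ hm hp₀ hp₀').mono ?_
  intro p hp
  exact ⟨hp.1, hp.2.1, hp.2.2.1, (hlaw p₀ p hp₀ hp₀' hp).mpr h₀⟩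

/-- **Kernel: dichotomy.** Under the same decidability, inside any set of primes `Q ⊆ {p ∤ 2Mm}` that
is a union of classes mod `m` (`p ∈ Q, p' ≡ p (mod m), p' ∤ 2Mm ⇒ p' ∈ Q`), the branch
`{p ∈ Q | law p}` is empty or infinite. [this file] -/
theorem door_branch_empty_or_infinite (hF : HeckeCongruencePrimesInfinite) {M : ℕ} [NeZero M]
    {k : ℤ} (hk : 1 ≤ k) {r : ℕ} (G : Fin r → CuspForm (Gamma0 M) k) (a : Fin r → ℕ → ℤ)
    (ha : ∀ i n, qCoeffs (G i) n = (a i n : ℂ)) {m j : ℕ} (hm : 0 < m) {law : ℕ → Prop}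
    (hlaw : DecidedBy M m j a law) {Q : Set ℕ}
    (hQ : ∀ p ∈ Q, p.Prime ∧ ¬ p ∣ 2 * M * m)
    (hQm : ∀ p ∈ Q, ∀ p' : ℕ, p'.Prime → ¬ p' ∣ 2 * M * m → p' ≡ p [MOD m] → p' ∈ Q) :
    {p | p ∈ Q ∧ law p} = ∅ ∨ Set.Infinite {p | p ∈ Q ∧ law p} := by
  by_cases h : ∃ p₀, p₀ ∈ Q ∧ law p₀
  · obtain ⟨p₀, hQ₀, h₀⟩ := h
    refine Or.inr ((door_branch_infinite hF hk G a ha hm hlaw (hQ p₀ hQ₀).1 (hQ p₀ hQ₀).2 h₀).mono ?_)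
    intro p hp
    exact ⟨hQm p₀ hQ₀ p hp.1 hp.2.1 hp.2.2.1, hp.2.2.2⟩
  · left
    ext p
    simp only [Set.mem_setOf_eq, Set.mem_empty_iff_false, iff_false, not_and]
    exact fun hp hl => h ⟨p, hp, hl⟩

/-! ### §4 The laws that ARE decided by congruence data: parity and exact `2`-adic order of `c(n₀ p)` -/

/-- `2^{v+1} ∣ x - y` ⇒ (`x` has exact order `v` iff `y` does). [this file] -/
theorem exactTwoPow_congr {v : ℕ} {x y : ℤ} (h : (2 : ℤ) ^ (v + 1) ∣ x - y) :
    ExactTwoPow v x ↔ ExactTwoPow v y := by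
  have hv : (2 : ℤ) ^ v ∣ x - y := (pow_dvd_pow 2 (Nat.le_succ v)).trans h
  constructor
  · rintro ⟨h1, h2⟩
    refine ⟨?_, fun hy => h2 ?_⟩
    · have := dvd_sub h1 hv; simpa using this
    · have := dvd_add hy h; simpa using this
  · rintro ⟨h1, h2⟩
    refine ⟨?_, fun hx => h2 ?_⟩
    · have := dvd_add h1 hv; simpa using this
    · have := dvd_sub hx h; simpa using this

/-- **The coefficient law is decided by the congruence data.** For `n₀` prime to every odd prime
outside `2Mm`'s... (we only need `n₀ ∣ 8`): the law `p ↦ (c(n₀ p) has exact 2-adic order v)`, with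
`c = a i₀` one of the integral `q`-expansions, is decided by the data `(m, v + 1, a)` as soon as
`n₀` is prime to `p p₀` — automatic for `n₀ ∈ {1, 2, 4, 8}` and odd `p, p₀`, which we encode by
`2 ∣ m` (so `p, p₀ ∤ 2Mm` are odd). [this file] -/
theorem decidedBy_exactTwoPow {M m v : ℕ} {r : ℕ} (a : Fin r → ℕ → ℤ) (i₀ : Fin r) {n₀ : ℕ}
    (hn₀ : n₀ ∣ 8) (hm : 2 ∣ m) :
    DecidedBy M m (v + 1) a (fun p => ExactTwoPow v (a i₀ (n₀ * p))) := by
  intro p₀ p hp₀ hp₀' hp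
  obtain ⟨hpP, hpd, -, hcong⟩ := hp
  have hodd : ∀ q : ℕ, q.Prime → ¬ q ∣ 2 * M * m → Nat.Coprime n₀ q := by
    intro q hq hqd
    have hq2 : q ≠ 2 := by
      rintro rfl; exact hqd (dvd_mul_of_dvd_right hm _)
    have : Nat.Coprime 8 q := by
      have h8 : (8 : ℕ) = 2 ^ 3 := by norm_num
      rw [h8]; exact Nat.Coprime.pow_left 3 ((Nat.coprime_primes Nat.prime_two hq).mpr (Ne.symm hq2))
    exact Nat.Coprime.coprime_dvd_left hn₀ this
  have hc : Nat.Coprime n₀ (p * p₀) :=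
    Nat.Coprime.mul_right (hodd p hpP hpd) (hodd p₀ hp₀ hp₀')
  exact exactTwoPow_congr (hcong i₀ n₀ hc)

/-- Same for the parity law `p ↦ Odd (c(n₀ p))` (data `(m, 1, a)`). [this file] -/
theorem decidedBy_odd {M m : ℕ} {r : ℕ} (a : Fin r → ℕ → ℤ) (i₀ : Fin r) {n₀ : ℕ}
    (hn₀ : n₀ ∣ 8) (hm : 2 ∣ m) :
    DecidedBy M m 1 a (fun p => Odd (a i₀ (n₀ * p))) := by
  have h := decidedBy_exactTwoPow (M := M) (v := 0) a i₀ hn₀ hm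
  intro p₀ p hp₀ hp₀' hp
  have key := h p₀ p hp₀ hp₀' hp
  have e : ∀ x : ℤ, ExactTwoPow 0 x ↔ Odd x := by
    intro x
    simp only [ExactTwoPow, pow_zero, one_dvd, true_and, zero_add, pow_one]
    rw [← even_iff_two_dvd, Int.not_even_iff_odd]
  simpa [e] using key

/-- Boolean combinations of decided laws are decided (regime A: the door law is an `𝔽₂`-linear
combination of two coefficient bits and the class of `p`). [this file] -/
theorem decidedBy_iff {M m j : ℕ} {r : ℕ} {a : Fin r → ℕ → ℤ} {l₁ l₂ : ℕ → Prop}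
    (h₁ : DecidedBy M m j a l₁) (h₂ : DecidedBy M m j a l₂) :
    DecidedBy M m j a (fun p => (l₁ p ↔ l₂ p)) := by
  intro p₀ p hp₀ hp₀' hp
  have e₁ := h₁ p₀ p hp₀ hp₀' hp; have e₂ := h₂ p₀ p hp₀ hp₀' hp
  constructor <;> intro h
  · exact e₁.symm.trans (h.trans e₂)
  · exact e₁.trans (h.trans e₂.symm)

/-- A law decided by the data is stable under negation. [folklore] -/
theorem decidedBy_not {M m j : ℕ} {r : ℕ} {a : Fin r → ℕ → ℤ} {l : ℕ → Prop}
    (h : DecidedBy M m j a l) : DecidedBy M m j a (fun p => ¬ l p) := by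
  intro p₀ p hp₀ hp₀' hp; exact not_congr (h p₀ p hp₀ hp₀' hp)

/-- Laws decided by the data are stable under conjunction. [folklore] -/
theorem decidedBy_and {M m j : ℕ} {r : ℕ} {a : Fin r → ℕ → ℤ} {l₁ l₂ : ℕ → Prop}
    (h₁ : DecidedBy M m j a l₁) (h₂ : DecidedBy M m j a l₂) :
    DecidedBy M m j a (fun p => l₁ p ∧ l₂ p) := by
  intro p₀ p hp₀ hp₀' hp; exact and_congr (h₁ p₀ p hp₀ hp₀' hp) (h₂ p₀ p hp₀ hp₀' hp)

/-- A law depending only on `p mod m` is decided. [this file] -/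
theorem decidedBy_of_mod {M m j : ℕ} {r : ℕ} {a : Fin r → ℕ → ℤ} {l : ℕ → Prop}
    (h : ∀ p p' : ℕ, p ≡ p' [MOD m] → (l p ↔ l p')) : DecidedBy M m j a l := by
  intro p₀ p _ _ hp; exact h p p₀ hp.2.2.1

/-! ### §5 The door schema: corank `=` order `= 3` on an infinite class of twists

The cell's door kernels (`Chi8Floor_v10`, `MatsunoBridgeAtTwo`, regime-A identities; GEN 42–43) give,
for a base `E₀ ↔ f₀` and door primes `q` (a union of classes mod `m = 8 N₀`, `a_q(f₀)` odd), the
equivalence `corank Sel_{2^∞}(A_q) = ord_T L₂(A_q) = 3 ↔ hS(q)` and, via `KohnenSquareLaw`, `hS(q) ↔`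
an `𝔽₂`-combination of `ExactTwoPow`-laws of `c(n₀ q)` for the Kohnen form (plus/minus face) and of
the class of `q`; `a_q(f₀) odd` is itself `Odd (a i (1 * q))` for the level-`4N₀` oldform `f₀(z)`.
So `Eq3` below is DECIDED, and the schema applies verbatim, IN THE MINIMAL-ORDER REGIME: with
`G = g θ ∈ S₂(Γ₀(4N₀))` one has `a_G(n) = c(n) + 2 ∑_{t ≥ 1} c(n - t²)` (Ono 2001, Lemma 3.3 (1)), so
the congruence data of `G` decide exactly the PARITY of `c(n₀ q)`, i.e. the law "`v₂ c(n₀ q) = 0` =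
the minimal order"; more generally, for a face `F` cut out by QUADRATIC conditions on `n` (`n mod 8`,
`(n/ℓ) = ε`) on which `2^s ∣ c(n)` uniformly, `G_F = (g_F / 2^s) θ` (`g_F` = restriction of `g` to
`F`, level `4N₀ · 64 ∏ ℓ²`, character still trivial) decides "`v₂ c(n₀ q) = s` = the minimal order
on `F`". Orders strictly above the face minimum are NOT reached by this device (no `Θ ≡ 1 (mod 4)`
of half-integral weight exists: every integral-weight product `g θ^{odd}` only sees `c mod 2`) — the
same reason Ono's theorems live at the minimal order `s₀`. For an equality door with floor
`v₂ c(n₀ q) ≥ v⋆` on door primes: if `v⋆ = s_F` for a quadratic face `F ⊇` the door positions (in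
particular if `v⋆ = 0`), the equality branch `{v₂ = v⋆}` IS the decided minimal-order law — one
instance makes it infinite, no instance possible makes it empty; if the face minimum `s_F` is
attained only OFF the door (at `n₀ q` with `a_q(f₀)` even, a non-quadratic condition) and `s_F < v⋆`,
the device does not decide the branch (recorded as the open sub-case; the data of kit j329245/6
say which bases are in which case). -/

/-- **Door schema.** If the door's equality predicate `Eq3` is equivalent on door primes to a law
decided by Hecke congruence data, then (one certified instance ⇒ infinitely many door primes with
`Eq3`) and (no instance needed ⇒ each branch empty or infinite). [this file] -/
theorem door_equality_branch (hF : HeckeCongruencePrimesInfinite) {M : ℕ} [NeZero M] {k : ℤ}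
    (hk : 1 ≤ k) {r : ℕ} (G : Fin r → CuspForm (Gamma0 M) k) (a : Fin r → ℕ → ℤ)
    (ha : ∀ i n, qCoeffs (G i) n = (a i n : ℂ)) {m j : ℕ} (hm : 0 < m)
    {Door : Set ℕ} (hQ : ∀ p ∈ Door, p.Prime ∧ ¬ p ∣ 2 * M * m)
    (hQm : ∀ p ∈ Door, ∀ p' : ℕ, p'.Prime → ¬ p' ∣ 2 * M * m → p' ≡ p [MOD m] → p' ∈ Door)
    {Eq3 law : ℕ → Prop} (hker : ∀ q ∈ Door, Eq3 q ↔ law q) (hlaw : DecidedBy M m j a law) :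
    ({q | q ∈ Door ∧ Eq3 q} = ∅ ∨ Set.Infinite {q | q ∈ Door ∧ Eq3 q}) ∧
    ({q | q ∈ Door ∧ ¬ Eq3 q} = ∅ ∨ Set.Infinite {q | q ∈ Door ∧ ¬ Eq3 q}) ∧
    (∀ q₀ ∈ Door, Eq3 q₀ → Set.Infinite {q | q ∈ Door ∧ Eq3 q}) := by
  have hset : {q | q ∈ Door ∧ Eq3 q} = {q | q ∈ Door ∧ law q} := by
    ext q; simp only [Set.mem_setOf_eq]; exact ⟨fun h => ⟨h.1, (hker q h.1).mp h.2⟩, fun h => ⟨h.1, (hker q h.1).mpr h.2⟩⟩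
  have hset' : {q | q ∈ Door ∧ ¬ Eq3 q} = {q | q ∈ Door ∧ ¬ law q} := by
    ext q; simp only [Set.mem_setOf_eq]; exact ⟨fun h => ⟨h.1, fun hl => h.2 ((hker q h.1).mpr hl)⟩, fun h => ⟨h.1, fun he => h.2 ((hker q h.1).mp he)⟩⟩
  refine ⟨?_, ?_, ?_⟩
  · rw [hset]; exact door_branch_empty_or_infinite hF hk G a ha hm hlaw hQ hQm
  · rw [hset']; exact door_branch_empty_or_infinite hF hk G a ha hm (decidedBy_not hlaw) hQ hQm
  · intro q₀ hq₀ h₀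
    rw [hset]
    refine (door_branch_infinite hF hk G a ha hm hlaw (hQ q₀ hq₀).1 (hQ q₀ hq₀).2 ((hker q₀ hq₀).mp h₀)).mono ?_
    intro q hq; exact ⟨hQm q₀ hq₀ q hq.1 hq.2.1 hq.2.2.1, hq.2.2.2⟩



/-! ### §6 Nebentypus / number-field coefficients (plus faces `S ≠ ∅`: `g_S ∈ S⁺_{3/2}(4N₀N′, χ)`, `G = g_S θ`
on `Γ₁`, coefficients in `𝓞 K`, congruences modulo a prime `𝔭 ∣ 2`) — the same fact and kernel -/

/-- **Hecke congruence primes, general form** (Deligne–Serre + Chebotarev; Ono 2001, Thm 2.2 and proof,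
for forms with Nebentypus): for finitely many cusp forms `G_i` of integral weight `k ≥ 1` on `Γ₁(M)`
whose `q`-expansions lie in the ring of integers `𝓞 K` of a number field `K ⊂ ℂ`, a prime ideal
`𝔭 ∋ 2` of `𝓞 K`, every `m ≥ 1`, `j`, and prime `p₀ ∤ 2Mm`: infinitely many primes `p ∤ 2Mm`,
`p ≡ p₀ (mod m)`, satisfy `a_i(np) ≡ a_i(np₀) (mod 𝔭^j)` for all `i` and all `n` prime to `p p₀`.
[cite: Ono2001Crelle, Thm 2.2 (p. 6) and proof] [cite: DeligneSerre1974, Thm 6.7] -/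
def HeckeCongruencePrimesInfinite' : Prop :=
  ∀ (M : ℕ) [NeZero M] (k : ℤ) (r : ℕ) (G : Fin r → CuspForm (Gamma1 M) k)
    (K : Type) [Field K] [NumberField K] (ι : K →+* ℂ) (𝔭 : Ideal (𝓞 K)) (a : Fin r → ℕ → 𝓞 K),
    1 ≤ k → 𝔭.IsPrime → (2 : 𝓞 K) ∈ 𝔭 → (∀ i n, qCoeffs (G i) n = ι (a i n)) →
    ∀ (m j p₀ : ℕ), 0 < m → p₀.Prime → ¬ p₀ ∣ 2 * M * m →
      Set.Infinite {p : ℕ | p.Prime ∧ ¬ p ∣ 2 * M * m ∧ p ≡ p₀ [MOD m] ∧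
        ∀ i n, Nat.Coprime n (p * p₀) → a i (n * p) - a i (n * p₀) ∈ 𝔭 ^ j}

/-- Congruence data, general form. [this file] -/
def CongData' (M m j : ℕ) {r : ℕ} {R : Type} [CommRing R] (𝔭 : Ideal R) (a : Fin r → ℕ → R)
    (p₀ p : ℕ) : Prop :=
  p.Prime ∧ ¬ p ∣ 2 * M * m ∧ p ≡ p₀ [MOD m] ∧
    ∀ i n, Nat.Coprime n (p * p₀) → a i (n * p) - a i (n * p₀) ∈ 𝔭 ^ j

/-- Decided laws, general form. [this file] -/
def DecidedBy' (M m j : ℕ) {r : ℕ} {R : Type} [CommRing R] (𝔭 : Ideal R) (a : Fin r → ℕ → R)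
    (law : ℕ → Prop) : Prop :=
  ∀ p₀ p : ℕ, p₀.Prime → ¬ p₀ ∣ 2 * M * m → CongData' M m j 𝔭 a p₀ p → (law p ↔ law p₀)

/-- **Kernel, general form: one instance ⇒ an infinite branch.** [this file] -/
theorem door_branch_infinite' (hF : HeckeCongruencePrimesInfinite') {M : ℕ} [NeZero M] {k : ℤ}
    (hk : 1 ≤ k) {r : ℕ} (G : Fin r → CuspForm (Gamma1 M) k) (K : Type) [Field K] [NumberField K]
    (ι : K →+* ℂ) (𝔭 : Ideal (𝓞 K)) (h𝔭 : 𝔭.IsPrime) (h2 : (2 : 𝓞 K) ∈ 𝔭) (a : Fin r → ℕ → 𝓞 K)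
    (ha : ∀ i n, qCoeffs (G i) n = ι (a i n)) {m j : ℕ} (hm : 0 < m) {law : ℕ → Prop}
    (hlaw : DecidedBy' M m j 𝔭 a law) {p₀ : ℕ} (hp₀ : p₀.Prime) (hp₀' : ¬ p₀ ∣ 2 * M * m)
    (h₀ : law p₀) :
    Set.Infinite {p : ℕ | p.Prime ∧ ¬ p ∣ 2 * M * m ∧ p ≡ p₀ [MOD m] ∧ law p} := by
  refine (hF M k r G K ι 𝔭 a hk h𝔭 h2 ha m j p₀ hm hp₀ hp₀').mono ?_
  intro p hp
  exact ⟨hp.1, hp.2.1, hp.2.2.1, (hlaw p₀ p hp₀ hp₀' hp).mpr h₀⟩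

/-- The `𝔭`-parity law `p ↦ c(n₀ p) ∉ 𝔭` (`n₀ ∣ 8`, `2 ∣ m`) is decided by the data `(m, 1, a)`.
[this file] -/
theorem decidedBy'_notMem {M m : ℕ} {r : ℕ} {R : Type} [CommRing R] (𝔭 : Ideal R)
    (a : Fin r → ℕ → R) (i₀ : Fin r) {n₀ : ℕ} (hn₀ : n₀ ∣ 8) (hm : 2 ∣ m) :
    DecidedBy' M m 1 𝔭 a (fun p => a i₀ (n₀ * p) ∉ 𝔭) := by
  intro p₀ p hp₀ hp₀' hp
  obtain ⟨hpP, hpd, -, hcong⟩ := hp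
  have hodd : ∀ q : ℕ, q.Prime → ¬ q ∣ 2 * M * m → Nat.Coprime n₀ q := by
    intro q hq hqd
    have hq2 : q ≠ 2 := by
      rintro rfl; exact hqd (dvd_mul_of_dvd_right hm _)
    have : Nat.Coprime 8 q := by
      have h8 : (8 : ℕ) = 2 ^ 3 := by norm_num
      rw [h8]; exact Nat.Coprime.pow_left 3 ((Nat.coprime_primes Nat.prime_two hq).mpr (Ne.symm hq2))
    exact Nat.Coprime.coprime_dvd_left hn₀ this
  have hc : Nat.Coprime n₀ (p * p₀) := Nat.Coprime.mul_right (hodd p hpP hpd) (hodd p₀ hp₀ hp₀')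
  have hd : a i₀ (n₀ * p) - a i₀ (n₀ * p₀) ∈ 𝔭 := by simpa using hcong i₀ n₀ hc
  refine not_congr ⟨fun h => ?_, fun h => ?_⟩
  · have := 𝔭.sub_mem h hd; simpa using this
  · have := 𝔭.add_mem h hd; simpa using this

end Summit.BirchSwinnertonDyer.Rank2.ChebotarevDoorAtTwo

end
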